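import Summits.CriticalPhenomena.PercolationContinuityZ3.Theorems.PercNearOneGluingNoHeavyConstsTwoSourceBHK
import Literature.Probability.Percolation.TwoClusterConditionalAssociation
import Literature.Probability.Percolation.KozmaNitzanPreFKG
import HarnessLib

/-!
# The three-point "diamond" inequality `P(ac|b)·P(bc|a) ≤ P(abc)·P(a|b|c)` — statement (conjectured gen 18, PROVED gen 19: see
# `…ConstsThreePointDiamondHolds.lean`), its van den Berg–Kahn shadow, and the two-source form (PAPER-2 track (ii); seat `prim-consts-2`)

builds on p205010 (kernel theorem, internal audit signed; external expert review pending).  Support file (`--supports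
stmt-CriticalPhenomena-4575`); memo `run/shared/lean/prim/consts/FROM-prim-consts-2-g18-XEDGE-CROSS.md` §0 addendum (8)–(13).  Two `Prop` definitions
(OPEN statements of this programme, tagged `@[conjecture]`), theorems; no sorries; standard axioms.

For three vertices `a, b, c` of a finite weighted graph write `P(abc)` (all three joined), `P(a|b|c)` (pairwise separated), `P(ac|b) = P(a↔c, c↮b)`,
`P(bc|a)`, `P(ab|c)` for the probabilities of the five partitions of `{a,b,c}` induced by the open clusters.  van den Berg–Kahn's Theorem 1.2 (source `c`,
`A = {a}`, `X = {b}`, `B = {b}`, `Y = {a}`; in the tree the two-source form `Consts.twoSource_twoSet`) gives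
  `P(ac|b)·P(bc|a) ≤ P(abc)·P(c ↮ {a,b}) = P(abc)·[P(a|b|c) + P(ab|c)]`   (`Consts.threePoint_vdBK`, PROVED here).
* `Consts.ThreePointDiamond` — **conjectured here (gen 18), PROVED on 2026-08-23 (status: THEOREM): the term `P(ab|c)` can be dropped:
  `P(ac|b)·P(bc|a) ≤ P(abc)·P(a|b|c)`.**  Three kernel proofs now in the tree: `Consts.threePointDiamond_holds` (`…ConstsThreePointDiamondHolds.lean`,
  this seat gen 19: it is an Ahlswede–Daykin four-events inequality — a configuration of `ac|b` and one of `bc|a` MEET in `a|b|c`, the rider `a↮b` being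
  inherited from the first factor, and JOIN in `abc`; also the two-source form), `ThreePointDiamondAnyEdge.diamond_all` (seat prim-l12-p1 gen 22,
  `…LowerTailThreePointDiamondAnyEdge.lean`: the margin is concave along every edge weight) and the Gladkov–Zimin cone row (`KernelRows.prodBernoulli_gzRow`
  at `Π₃`, referee prim-consts-3 g95).  ATTRIBUTION (added gen 21, after prim-sahi-lit finding L63-1 and referee prim-consts-3 g98): the
  STATEMENT is published — it is one of the three nonnegative terms of Gladkov's inequality `P(abc)·P(a|b|c) ≥ P(ab|c)P(ac|b) + P(ab|c)P(a|bc)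
  + P(ac|b)P(a|bc)` (Aas's inequality), a Literature theorem of the tree since 2026-08-19:
  `Literature.Probability.Percolation.prodBernoulli_threePoint_strongHarris` (and `…_strongHarris_term`, exactly this statement), from which
  `Consts.ThreePointDiamond` follows by dropping two products; what is new here is only the proof routes (four events / edge concavity / cone row),
  the two-source form with its rider, and the censuses.  The text below is the gen-18 record, kept verbatim except for the status.
  Equivalently `P(abc)·P(a|b|c) ≥` the product of ANY TWO of `P(ab|c), P(ac|b), P(bc|a)` (apply it with each pivot); equality on every series
  configuration (pivot `c` a cut vertex between `a` and `b`).  The "rider" `a ↮ b` in the last factor is what no conditional-association inequality of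
  van den Berg–Häggström–Kahn (Thms 1.1–1.5, 2.1) produces: each of their conditionings contains only two of the four events.  The quantity
  `P(abc)P(a|b|c) − P(ac|b)P(a|bc)` is the one of Gladkov's Conjecture 10.1 (= Gladkov–Zimin Conj. 6.3), which is an UPPER bound (it asks that this quantity be
  small when `P(ab|c)` is small) and is untouched by the nonnegativity statement here.  EVIDENCE before the proofs (exact rational arithmetic; engines
  `engines/probe_3pt.py`, `climb3pt.py` of this seat): 0 violations
  on 1 040 random weighted graphs `n ≤ 7` and along 168 000 corner-seeking climbs (`n ≤ 7`, `m ≤ 10`, weights on `{2⁻ᵏ, 1−2⁻ᵏ, 1/3, 2/3, 1/5, 4/5}`, objective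
  `P(a|b|c)P(abc)/(P(ac|b)P(bc|a))`, exact end points; minimum exactly `1`, attained on the series family).
* `Consts.ThreePointDiamondTwoSource` — **the two-source form (PROVED: `Consts.threePointDiamondTwoSource_holds`, gen 19)**, for source SETS `S₁, S₂`:
  `P(S₁↔a, S₁↮b)·P(S₂↔b, S₂↮a) ≤ P(S₁∪S₂↔a, S₁∪S₂↔b)·P(S₁∩S₂↮a, S₁∩S₂↮b, a↮b)` — the Ahlswede–Daykin lattice shape (union on the connection side,
  intersection on the avoidance side, exactly as in `Consts.twoSource_twoSet`, plus the rider `a↮b`); 0 violations on ≈ 5 000 exact instances (seven shapes of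
  `(S₁,S₂)`, `n ≤ 7`).  `Consts.threePointDiamond_of_twoSource`: it implies the one-source conjecture.
WHY HERE: the CROSS members of MDL(X)′ at `u = z` (memo (8),(11)) contain exactly such "exchange with a rider" inequalities
(`μ(T')μ(D∩Z∩U) ≥ μ(T∩W)μ(D∖Z∩Y∩U)` for every up-event `U` of `C_s`); the three-point diamond is their F-free, X-free skeleton.
[cite: VandenbergKahn2001, Thm. 1.2 (p. 123) and Remark 1] [cite: VandenbergHaggstromKahn2005, Thm. 1.1 (pp. 3–5)]
[cite: Gladkov2024, Conjecture 10.1 (p. 18), Theorem 1.3 (p. 2)] [cite: Gladkov2024StrongFKG, Cor. 4.2 (one term of the left side)]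
-/

noncomputable section

namespace Summit.CriticalPhenomena.PercolationContinuityZ3.Theorems

open MeasureTheory Set Literature.Probability.LatticeModels Literature.Probability.Percolation
open scoped Classical

namespace Consts

variable {V : Type*} [Fintype V]

/-- **Three-point diamond — conjectured here (gen 18), PROVED (status: theorem; `Consts.threePointDiamond_holds` in `…ConstsThreePointDiamondHolds.lean`,
independently `ThreePointDiamondAnyEdge.diamond_all` in `…LowerTailThreePointDiamondAnyEdge.lean`; the `def` is kept because both files close it by name).**
For every finite weighted graph and vertices `a, b, c`:
`P(a↔c, c↮b) · P(b↔c, c↮a) ≤ P(a↔c, b↔c) · P(a↮b, a↮c, b↮c)`, i.e. `P(ac|b)·P(bc|a) ≤ P(abc)·P(a|b|c)`.  van den Berg–Kahn's Theorem 1.2 gives the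
same with `P(a|b|c) + P(ab|c)` in place of `P(a|b|c)` (`Consts.threePoint_vdBK`); Gladkov's Conjecture 10.1 is an UPPER bound on
`P(abc)P(a|b|c) − P(ac|b)P(bc|a)` and is not addressed.  Exact census and 168 000 adversarial climbs (`n ≤ 7`) preceded the proofs: 0 violations, equality on
series configurations.  ATTRIBUTION: the statement is one term of Gladkov's published inequality (Aas's inequality), in the tree as
`Literature.Probability.Percolation.prodBernoulli_threePoint_strongHarris_term`; only the proofs and censuses recorded here are this programme's.
builds on p205010 (kernel theorem, internal audit signed; external expert review pending).
[cite: VandenbergKahn2001, Thm. 1.2 (p. 123)] [cite: Gladkov2024, Conjecture 10.1 (p. 18)] [cite: Gladkov2024StrongFKG, Cor. 4.2 (one term of the left side)]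
[status: proved — `Consts.threePointDiamond_holds`; published statement] -/
@[conjecture] def ThreePointDiamond : Prop :=
  ∀ (n : ℕ) (w : Sym2 (Fin n) → unitInterval) (a b c : Fin n),
    (prodBernoulli w).real (openConn c a ∩ (openConn c b)ᶜ) * (prodBernoulli w).real (openConn c b ∩ (openConn c a)ᶜ) ≤
      (prodBernoulli w).real (openConn c a ∩ openConn c b) *
        (prodBernoulli w).real ((openConn c a)ᶜ ∩ (openConn c b)ᶜ ∩ (openConn a b)ᶜ)

/-- **Three-point diamond, two-source form — conjectured here (gen 18), PROVED (status: theorem; `Consts.threePointDiamondTwoSource_holds` in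
`…ConstsThreePointDiamondHolds.lean`: an Ahlswede–Daykin four-events inequality via `prodBernoulli_fourEvents`).**  For vertex sets `S₁, S₂` and
vertices `a, b`, with `{S ↔ v} = ⋃_{s∈S}{s ↔ v}`:  `P(S₁↔a, S₁↮b) · P(S₂↔b, S₂↮a) ≤ P(S₁∪S₂↔a, S₁∪S₂↔b) · P(S₁∩S₂↮a, S₁∩S₂↮b, a↮b)` — the
Ahlswede–Daykin shape of `Consts.twoSource_twoSet` (which gives it WITHOUT the rider `a ↮ b`).  Exact census before the proof (seven shapes of `(S₁,S₂)`,
`n ≤ 7`): 0 violations.  builds on p205010 (kernel theorem, internal audit signed; external expert review pending).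
[cite: VandenbergHaggstromKahn2005, Thm. 1.1 (pp. 3–5), Remark 1 after Thm. 1.2 (p. 5)] [status: proved — `Consts.threePointDiamondTwoSource_holds`] -/
@[conjecture] def ThreePointDiamondTwoSource : Prop :=
  ∀ (n : ℕ) (w : Sym2 (Fin n) → unitInterval) (S₁ S₂ : Set (Fin n)) (a b : Fin n),
    (prodBernoulli w).real ((⋃ s ∈ S₁, openConn s a) ∩ {ω | ∀ s ∈ S₁, ¬ (openGraph ω).Reachable s b}) *
        (prodBernoulli w).real ((⋃ s ∈ S₂, openConn s b) ∩ {ω | ∀ s ∈ S₂, ¬ (openGraph ω).Reachable s a}) ≤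
      (prodBernoulli w).real ((⋃ s ∈ S₁ ∪ S₂, openConn s a) ∩ (⋃ s ∈ S₁ ∪ S₂, openConn s b)) *
        (prodBernoulli w).real ({ω | ∀ s ∈ S₁ ∩ S₂, ¬ (openGraph ω).Reachable s a ∧ ¬ (openGraph ω).Reachable s b} ∩ (openConn a b)ᶜ)

omit [Fintype V] in
/-- `⋃_{s ∈ {c}} {s ↔ v} = {c ↔ v}`. [folklore] -/
theorem biUnion_singleton_openConn (c v : V) : (⋃ s ∈ ({c} : Set V), openConn s v) = (openConn c v : Set (BondConfig V)) := by
  ext ω; simp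

/-- The two-source conjecture implies the one-source one (`S₁ = S₂ = {c}`). [cite: VandenbergHaggstromKahn2005, Remark 1 after Thm. 1.2 (p. 5)] -/
theorem threePointDiamond_of_twoSource (h : ThreePointDiamondTwoSource) : ThreePointDiamond := by
  intro n w a b c
  have key := h n w {c} {c} a b
  have e1 : ((⋃ s ∈ ({c} : Set (Fin n)), openConn s a) ∩ {ω : BondConfig (Fin n) | ∀ s ∈ ({c} : Set (Fin n)), ¬ (openGraph ω).Reachable s b})
      = (openConn c a ∩ (openConn c b)ᶜ : Set (BondConfig (Fin n))) := by
    ext ω; simp [openConn]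
  have e2 : ((⋃ s ∈ ({c} : Set (Fin n)), openConn s b) ∩ {ω : BondConfig (Fin n) | ∀ s ∈ ({c} : Set (Fin n)), ¬ (openGraph ω).Reachable s a})
      = (openConn c b ∩ (openConn c a)ᶜ : Set (BondConfig (Fin n))) := by
    ext ω; simp [openConn]
  have e3 : ((⋃ s ∈ ({c} ∪ {c} : Set (Fin n)), openConn s a) ∩ (⋃ s ∈ ({c} ∪ {c} : Set (Fin n)), openConn s b))
      = (openConn c a ∩ openConn c b : Set (BondConfig (Fin n))) := by
    ext ω; simp
  have e4 : ({ω : BondConfig (Fin n) | ∀ s ∈ ({c} ∩ {c} : Set (Fin n)), ¬ (openGraph ω).Reachable s a ∧ ¬ (openGraph ω).Reachable s b}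
        ∩ (openConn a b)ᶜ) = ((openConn c a)ᶜ ∩ (openConn c b)ᶜ ∩ (openConn a b)ᶜ : Set (BondConfig (Fin n))) := by
    ext ω; simp [openConn]
  rw [e1, e2, e3, e4] at key
  exact key

/-- **THEOREM (van den Berg–Kahn's shadow of the diamond).**  `P(a↔c, c↮b)·P(b↔c, c↮a) ≤ P(a↔c, b↔c)·P(c↮a, c↮b)` — van den Berg–Kahn's
Theorem 1.2 for the source `c`, `A = {a}`, `X = {b}`, `B = {b}`, `Y = {a}` (here from the tree's two-source form `Consts.twoSource_twoSet` with
`S = S' = {c}`).  The last factor is `P(a|b|c) + P(ab|c)`; the conjecture `Consts.ThreePointDiamond` drops `P(ab|c)`.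
[cite: VandenbergKahn2001, Thm. 1.2 (p. 123)] [cite: VandenbergHaggstromKahn2005, Thm. 1.1 (pp. 3–5)] -/
theorem threePoint_vdBK (w : Sym2 V → unitInterval) (a b c : V) :
    (prodBernoulli w).real (openConn c a ∩ (openConn c b)ᶜ) * (prodBernoulli w).real (openConn c b ∩ (openConn c a)ᶜ) ≤
      (prodBernoulli w).real (openConn c a ∩ openConn c b) *
        (prodBernoulli w).real ((openConn c a)ᶜ ∩ (openConn c b)ᶜ) := by
  set μ := prodBernoulli w with hμ
  by_cases hab : a = b
  · subst hab
    rw [Set.inter_compl_self, measureReal_empty, zero_mul]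
    exact mul_nonneg measureReal_nonneg measureReal_nonneg
  have key := twoSource_twoSet w {c} {c} {b} {a} (connIndicatorFn c a) (connIndicatorFn c b)
    (monotone_connIndicatorFn c a) (monotone_connIndicatorFn c b)
    (fun C => by unfold connIndicatorFn; split_ifs <;> norm_num) (fun C => by unfold connIndicatorFn; split_ifs <;> norm_num)
  -- read the clusters and the events
  have hcl : ∀ ω : BondConfig V, (⋃ s ∈ ({c} : Set V), openEdgeCluster ω s) = openEdgeCluster ω c := by
    intro ω; ext e; simp
  have hcl2 : ∀ ω : BondConfig V, (⋃ s ∈ ({c} ∪ {c} : Set V), openEdgeCluster ω s) = openEdgeCluster ω c := by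
    intro ω; ext e; simp
  simp only [hcl, hcl2, connIndicatorFn_openEdgeCluster] at key
  have s1 : {ω : BondConfig V | ∀ s ∈ ({c} : Set V), ∀ x ∈ ({b} : Set V), ¬ (openGraph ω).Reachable s x} = (openConn c b)ᶜ := by
    ext ω; simp [openConn]
  have s2 : {ω : BondConfig V | ∀ s ∈ ({c} : Set V), ∀ x ∈ ({a} : Set V), ¬ (openGraph ω).Reachable s x} = (openConn c a)ᶜ := by
    ext ω; simp [openConn]
  have s3 : {ω : BondConfig V | ∀ s ∈ ({c} ∪ {c} : Set V), ∀ x ∈ ({b} ∩ {a} : Set V), ¬ (openGraph ω).Reachable s x} = Set.univ := by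
    ext ω
    simp only [Set.mem_setOf_eq, Set.mem_univ, iff_true]
    intro s _ x hx
    simp only [Set.mem_inter_iff, Set.mem_singleton_iff] at hx
    exact absurd (hx.2.symm.trans hx.1) hab
  have s4 : {ω : BondConfig V | ∀ s ∈ ({c} ∩ {c} : Set V), ∀ x ∈ ({b} ∪ {a} : Set V), ¬ (openGraph ω).Reachable s x} =
      (openConn c a)ᶜ ∩ (openConn c b)ᶜ := by
    ext ω
    simp only [Set.inter_self, Set.mem_singleton_iff, forall_eq, Set.union_singleton, Set.mem_insert_iff, Set.mem_setOf_eq,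
      Set.mem_inter_iff, Set.mem_compl_iff, openConn]
    constructor
    · intro h; exact ⟨h a (Or.inl rfl), h b (Or.inr rfl)⟩
    · rintro ⟨ha, hb⟩ x hx
      rcases hx with rfl | rfl
      · exact ha
      · exact hb
  rw [s1, s2, s3, s4] at key
  have hprod : (fun ω : BondConfig V => (openConn c a).indicator (1 : BondConfig V → ℝ) ω * (openConn c b).indicator 1 ω) =
      (openConn c a ∩ openConn c b).indicator 1 := by
    funext ω
    rw [Set.inter_indicator_one]
    rfl
  simp only [hprod] at key
  rw [KNPreFKG.setIntegral_indicator_one_eq μ, KNPreFKG.setIntegral_indicator_one_eq μ,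
    KNPreFKG.setIntegral_indicator_one_eq μ, Set.univ_inter, Set.inter_comm (openConn c b)ᶜ,
    Set.inter_comm (openConn c a)ᶜ (openConn c b)] at key
  exact key

end Consts

end Summit.CriticalPhenomena.PercolationContinuityZ3.Theorems

end
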